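import Literature.NumberTheory.ComplexMultiplication.SerreLefschetzSquareLimit
import Literature.NumberTheory.ComplexMultiplication.CosetGermGaloisPairProduct
import Literature.NumberTheory.ComplexMultiplication.CosetGermSufficientlyLargeFields
import HarnessLib

/-!
# Milne 1999 §6 THEOREM 6.1 IN THE LIMIT, on characters: «the Serre and Lefschetz groups intersect in the Weil-number torus» — the commuting
# square `X^*(T) → X^*(S)` over `X^*(L) → X^*(P)` of g21-#1 is ALMOST CARTESIAN (`X^*(T) → X^*(L) ⊕ X^*(S) → X^*(P)` exact; `P = L ∩ S` on characters)
# (J. S. Milne, *Lefschetz motives and the Tate conjecture*, Compositio Math. 117 (1999), §6 pp. 66–72)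

Family `hodge`, lane `lit-hodgefound` (Layer A3; seat `lit-hodgefound-p27`, generation 21, row g21-#2); topic `NumberTheory/ComplexMultiplication`.
Companion of g21-#1 `SerreLefschetzSquareLimit` (the four character modules `X^*(T) = TChar`, `X^*(S) = infinityTypesCM`, `X^*(L) = LChar p`,
`X^*(P) = Additive (WeilLimit p)`, the maps `gammaT`, `alphaPrimeT p 𝔴`, `betaL p`, `alphaLim p 𝔴`, LEMMA 6.2 «the diagram commutes», all four maps onto),
of g18-#7 `CosetGermGaloisPairProduct` (THEOREM 6.1 AT A FINITE LEVEL `K` on `K`'s own character modules `TKK`, `LKK`: `exact_pairProductK` for a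
`CosetGerm.Setting`), of g18-#1 `CosetGermGaloisSetting` (`cosetGermSetting`: the Setting of a Galois CM field containing an imaginary quadratic `Q` with `(p)`
split) and of g19-#3 `CosetGermSufficientlyLargeFields` (such fields are cofinal).  THIS FILE passes to the limit over the finite Galois CM levels
`E ⊂ ℚ^{cm}` («On passing to the limit over all K ⊂ ℚ^{cm}», p. 66 L33): it builds the LEVEL MAPS `X^*(T^E)(E) → X^*(T)`, `X^*(L^E)(E) → X^*(L)`, proves
their compatibility with `γ`, `β`, `α′`, `α`, shows that every pair `(y, n) ∈ X^*(L) × X^*(S)` is carried by ONE level with a Setting, and concludes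
THEOREM 6.1 on characters for the limit square.  Everything is PROVED (0 `sorry`, 0 new axioms; kind definition — the level maps are definitions —, no
named fact, net debt 0, D-0026).

* §1 THE `T`-SIDE LEVEL MAP.  `extendCMType_smul` (`(σΦ)^{ℚ^{cm}} = σΦ^{ℚ^{cm}}`), **`tIdx`** (the class of `Γ·Φ^{ℚ^{cm}}`), **`extendOrbitMap : Γ·Φ₀ → Γ·Ψ_base`,
  `Φ ↦ Φ^{ℚ^{cm}}`** (`_smul`: equivariant), **`tLevelOrbit : X^*(T^Ψ)(K) → X^*(T^{Ψ(ℚ^{cm})})`** (g16-#6 `OrbitTorus.push`; `_mk_single`, `_tCM : t^Ψ ↦ t`,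
  `_rep`), **`gammaChar_comp_tLevelOrbit`** (compatibility with `γ` on a summand: both give `𝟙_{Φ^{ℚ^{cm}}} = λ_Φ^{ℚ^{cm}}`, g21-#1 `indicatorI_extendCMType`),
  **`tSumLevel`, `tLevel : TKK p 𝔭 τ₀ h → TChar`** for any finite Galois CM level `K ⊂ ℚ^{cm}`, prime `𝔭 | p` of `K`, embedding `τ₀` and `Setting h`
  (`tSumLevel_single`, `_single_tFamK : δ_c t^{Ψ_c} ↦ t`, `tLevel_mk`, **`tLevel_tKK : t^K ↦ t`**), **`gammaT_comp_tLevel : X^*(γ) ∘ tLevel = extendLevel K ∘ X^*(γ^K)`**.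
* §2 THE `L`-SIDE LEVEL MAP.  **`lLevelOrbit : X^*(L^Π)(K) ≅ X^*(L^Π)`** (g21-#1 `orbitCharCongr`; `_mk_single`, `_lWeil`, `_rep`), `dinj_lFamL_mk_single_eq`,
  `weilLimitInSubtype_injective'`, **`betaChar_comp_lLevelOrbit`** (compatibility with `β` on a summand: both give `[π]`), **`lSumLevel`, `lLevel : LKK p 𝔭 τ₀ h →
  LChar p`** (`lSumLevel_single`, `_single_lFamK : δ_{c′} l^{Π_{c′}} ↦ l`, `lLevel_mk`, **`lLevel_lKK : l^K ↦ l`**), **`betaL_comp_lLevel : X^*(β) ∘ lLevel =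
  (X^*(P^K) ↪ X^*(P)) ∘ X^*(β^K)`**.
* §3 AT THE COHERENT PRIME `𝔭 = 𝔴 ∩ E` of a finite Galois CM level `E ⊂ ℚ^{cm}`: `cmTypeGerm_congr_prime`, **`cmTypeGermLim_extendCMType_of_eq : π(Φ^{ℚ^{cm}}) = π(Φ)`**
  (g21-#1), **`alphaLim_extendLevel_of_eq : X^*(α) ∘ extendLevel E = (X^*(P^E) ↪ X^*(P)) ∘ X^*(α^E)`** (g20-#3 `alphaLim_extendLevel`),
  **`alphaPrimeOrbit_comp_tLevelOrbit`** / **`alphaPrimeT_comp_tLevel : X^*(α′) ∘ tLevel = lLevel ∘ X^*(α′^E)`** (on `[δ_Φ]` both give `[δ_{π(Φ)}]`; g18-#7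
  `orbit_cmTypeGerm_repType`, `germCast`), and **`exists_lift_of_level`**: THEOREM 6.1 at level `E` (g18-#7 `exact_pairProductK`) pushed into the limit
  objects — if `y ∈ X^*(L^E)(E)` and `g ∈ X^*(S^E)` agree in `X^*(P)` they come from `X^*(T)`.
* §4 THE LEVELS EXHAUST AND THE LEVELS WITH A SETTING ARE COFINAL.  `ncard_primesOver_eq_two_of_algEquiv` (two primes over `p` is invariant under `Q ≃ Q′`
  for quadratic fields, through the tree's decomposition law), **`exists_level_ge_with_split_quadratic`** (every finite Galois level of `ℚ^{cm}` lies in one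
  containing a quadratic `Q`, not totally real, with `(p)` split — g19-#3's `Q ⊂ ℂ` is CM, hence in `ℚ^{cm}`, adjoined through its Galois closure),
  **`levelGens` / `levelSpan p E hI`** (the part of `X^*(L)` carried by `E ∋ i`: the `[δ_Π r δ_π]`, `π ∈ W^E(p^∞)`; `_mono`), **`exists_level_mem_levelSpan`**
  (every `y ∈ X^*(L)` is carried by some level: g21-#1 `exists_finiteGaloisLevel_mem_weilLimitIn`, directedness), `cmTypeGerm_mem_orbit_repGerm` (g18-#7's
  `cmTypeGerm_repType_mem_orbit` for an arbitrary CM type), **`dinj_mk_single_mem_range_lLevel`**, **`levelSpan_le_range_lLevel`** (a level with a Setting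
  carries its generators THROUGH `lLevel`: `π = σ·π(Φ)` by LEMMA 5.1, g16-#6 `exists_cmTypeGerm_eq`).
* §5 **THEOREM 6.1 IN THE LIMIT, ON CHARACTERS.**  `exists_lift_of_carried`, **`exists_lift`** (`β(y) = α(n) ⇒ ∃ x, α′(x) = y ∧ γ(x) = n`),
  **`isAlmostCartesian_charSquare : IsAlmostCartesian (alphaPrimeT p 𝔴) gammaT (betaL p) (alphaLim p 𝔴)`**, **`betaL_eq_alphaLim_iff`**,
  **`exact_charSquare`** (LEMMA 6.3 (c): `X^*(T) → X^*(L) ⊕ X^*(S) → X^*(P)` exact), **`kerMap_surjective_charSquare`** / **`_symm`** (LEMMA 6.3 (b):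
  `Ker X^*(γ) → Ker X^*(β)` and `Ker X^*(α′) → Ker X^*(α)` onto).

Architecture of the printed proof and of this file.  Milne proves the level-`K` square almost cartesian «for all sufficiently large CM-fields `K ⊂ ℚ^{al}` …
We shall in fact prove it under the assumption that `K` – is finite and Galois over `ℚ`, – contains a quadratic imaginary extension `Q` of `ℚ` in which `(p)`
splits» (p. 68 L115 – p. 69 L7; = g18-#1/#7), and passes to the limit (p. 66 L33–L49).  Here the limit is taken literally: the limit objects of g21-#1 are
the amalgamated direct sums over ALL `Γ`-orbits, the level maps of §§1–2 embed `K`'s own pair products into them compatibly with the four arrows (§§1–3),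
the union of their images is everything (§4), and a lift at an admissible level is a lift in the limit (§§3, 5) — the almost-cartesian property is
inherited by this directed union because the data `(y, n)` of a lifting problem is finite.

SCOPE (docstring, not claims).  (1) As in g21-#1, `T`, `S`, `L`, `P` enter ONLY through their character modules; the identifications with fundamental groups
of `LCM(ℚ^{al})`, `CM(ℚ^{al})`, `LMot(𝔽)`, `⟨motive of a Weil number⟩` (Thm 2.6, Thm 4.3, Thm 5.4) are NOT formalised, so «identifies `P` with `L ∩ S`
(intersection in `T`)» as a statement about affine group schemes / Tannakian categories is NOT claimed — only its character-level content, to which p. 66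
reduces it («To complete the proof of Theorem 6.1 we shall show that … is exact», «it remains to show that the right hand square is almost cartesian»).
(2) The prime: §6 fixes a prime `w₀` of `ℚ^{al}` over `p`; here `𝔴` is a prime of `𝓞_{ℚ^{cm}}` over `p` and every level is read at `𝔴 ∩ E` (g20-#3).
(3) The level maps are stated for an ARBITRARY prime `𝔭 | p` and embedding `τ₀` of the level (§§1–2) and specialised to `𝔭 = 𝔴 ∩ E` through an equation
`h𝔭𝔴 : 𝔭 = 𝔴.under _` (§3) — an implementation choice (instance search on the subtype levels `↥E` is slow on compound prime terms), not mathematics.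
(4) `R`-points (`P(R) = L(R) ×_{T(R)} S(R)`) are not in this file.  (5) Nothing in this file is a case of the Hodge conjecture.

## References

* [Milne1999] J. S. Milne, *Lefschetz motives and the Tate conjecture*, Compositio Math. 117 (1999) 45–76 — §6 p. 66 L5–L6 (THEOREM 6.1 «The diagram
  at left commutes, and identifies P with L ∩ S (intersection in T)»), L7–L12 (Lemma 6.2), L33–L49 («On passing to the limit over all K ⊂ ℚ^{cm} … To
  complete the proof of Theorem 6.1 we shall show that P^K = S^K ∩ L^K (inside T^K), or, equivalently, that P^K → L^K × S^K → T^K is exact, for all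
  sufficiently large K»), L50 ff. («Almost cartesian squares»); p. 67 L5–L23 (Lemma 6.3 (a) ⇔ (b) ⇔ (c)), L25 ff. (Lemma 6.4); p. 68 L112 – p. 69 L7 («is
  almost Cartesian for all sufficiently large CM-fields K … We shall in fact prove it under the assumption that K – is finite and Galois over ℚ, – contains
  a quadratic imaginary extension Q of ℚ in which (p) splits»); p. 71 L15–L17, p. 72 L4–L7 («Therefore the right-hand square is almost Cartesian, which
  completes the proof of Theorem 6.1»); §2 p. 54 L33–L36 (`ψ_τ` as a CM-type on `ℚ^{cm}`), Thm 2.6 p. 56; §4 p. 60 L22–L27, Thm 4.3 p. 61, p. 62 L17–L31;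
  §5 p. 63 L6–L9, Lemma 5.1, Rem. 5.2 (a), p. 64 L62 – p. 65 L9 (held `paper:doi-10-1023-a-1000776613765` p0010, p0012, p0016–p0018, p0019–p0021,
  p0022–p0025, p0027–p0028; printed page = PDF page + 44).
* [MilneCM2006] J. S. Milne, *Complex Multiplication* (course notes), Ch. I §1 p. 19 (CM-types on `ℚ^{cm}` are extended from CM-subfields), §4 pp. 40–42.
* [Marcus2018] D. A. Marcus, *Number Fields*, 2nd ed., Springer 2018 — Ch. 3 Thm. 25 (decomposition of `p` in quadratic fields; the tree's
  `QuadraticFields.KroneckerSplitting`).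

Provenance: lane `lit-hodgefound`, seat `lit-hodgefound-p27` gen 21 (agent `literature-prover-lit-hodgefound-p27-g21-0`), row g21-#2 (lane INBOX claim
2026-08-24, l.10417).
-/

set_option autoImplicit false

noncomputable section

open scoped NumberField DirectSum Pointwise IntermediateField TensorProduct

namespace Literature.NumberTheory.ComplexMultiplication

namespace CMNumbers

open _root_.NumberField
open Literature.NumberTheory.NumberFields (cmNumbers cmNumbersConj cmNumbersConj_mul_self cmNumbersConj_mul_comm isCMField_adjoin_I
  le_cmNumbers_of_isCMField isCMField_of_ringEquiv not_isCMField_of_isTotallyReal)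
open PairProduct (DAmalg dinj dliftOf)
open CosetGerm (Setting CMOrbits WeilGerms WeilOrbits red)
open AlmostCartesian (IsAlmostCartesian)

/-! ### §1 The `T`-side level map `X^*(T^K)(K) → X^*(T)` of a finite CM level `K ⊂ ℚ^{cm}` and its compatibility with `γ` -/

section TLevel

variable (p : ℕ) [hp : Fact p.Prime]
variable (K : IntermediateField ℚ cmNumbers) [FiniteDimensional ℚ K]

/-- `(σΦ)^{ℚ^{cm}} = σ·Φ^{ℚ^{cm}}`: extending CM types of the level `K` to `ℚ^{cm}` is `Γ`-equivariant. [cite: Milne1999, §2 p. 54 L39–L42 («ψ_{ρ∘τ}(σ) = ψ_τ(ρ⁻¹∘σ) = (ρψ_τ)(σ)»)] -/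
theorem extendCMType_smul {Φ : Set (K →ₐ[ℚ] cmNumbers)} (hΦ : IsCMTypeWith (cmNumbersConj : cmNumbers ≃ₐ[ℚ] cmNumbers) Φ)
    (σ : cmNumbers ≃ₐ[ℚ] cmNumbers) (hσΦ : IsCMTypeWith (cmNumbersConj : cmNumbers ≃ₐ[ℚ] cmNumbers) (σ • Φ)) :
    extendCMType K hσΦ = σ • extendCMType K hΦ := by
  refine Subtype.ext (Set.ext fun ρ => ?_)
  rw [GalCMType.coe_smul, Set.mem_smul_set_iff_inv_smul_mem]
  change resLevel K ρ ∈ σ • Φ ↔ resLevel K (σ⁻¹ • ρ) ∈ Φ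
  rw [Set.mem_smul_set_iff_inv_smul_mem, smul_eq_mul, resLevel_mul]

/-- `Φ^{ℚ^{cm}}` depends only on the set `Φ`. [cite: Milne1999, §2 p. 54 L33–L36] -/
theorem extendCMType_congr {Φ Φ' : Set (K →ₐ[ℚ] cmNumbers)} (hΦ : IsCMTypeWith (cmNumbersConj : cmNumbers ≃ₐ[ℚ] cmNumbers) Φ)
    (hΦ' : IsCMTypeWith (cmNumbersConj : cmNumbers ≃ₐ[ℚ] cmNumbers) Φ') (e : Φ = Φ') : extendCMType K hΦ = extendCMType K hΦ' := by
  subst e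
  rfl

variable {K}

/-- **The class in `Γ\{CM-types on ℚ^{cm}}` of the orbit `Ψ = Γ·Φ₀` of a CM type of the level `K`** (read through `Φ ↦ Φ^{ℚ^{cm}}`).
[cite: Milne1999, §2 Thm 2.6 p. 56 («the set of Γ-orbits of CM-types on K»), p. 54 L33–L36] -/
def tIdx {Φ₀ : Set (K →ₐ[ℚ] cmNumbers)} (h₀ : IsCMTypeWith (cmNumbersConj : cmNumbers ≃ₐ[ℚ] cmNumbers) Φ₀) : CMTypeOrbits :=
  Quotient.mk'' (extendCMType K h₀)

/-- **`Ψ(K) → Ψ(ℚ^{cm})`, `Φ ↦ Φ^{ℚ^{cm}}`**: the orbit of a CM type `Φ₀` of `K` maps into the orbit of the base point of its class.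
[cite: Milne1999, §2 p. 54 L33–L36 («as τ runs over the embeddings … ψ_τ runs over a Γ-orbit of CM-types on ℚ^{cm}»)] -/
def extendOrbitMap {Φ₀ : Set (K →ₐ[ℚ] cmNumbers)} (h₀ : IsCMTypeWith (cmNumbersConj : cmNumbers ≃ₐ[ℚ] cmNumbers) Φ₀)
    (Φ : MulAction.orbit (cmNumbers ≃ₐ[ℚ] cmNumbers) Φ₀) : MulAction.orbit (cmNumbers ≃ₐ[ℚ] cmNumbers) (orbitBase (tIdx h₀)) :=
  ⟨extendCMType K (isCMTypeWith_of_mem_orbit h₀ Φ), by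
    change _ ∈ MulAction.orbit (cmNumbers ≃ₐ[ℚ] cmNumbers) (orbitBase (Quotient.mk'' (extendCMType K h₀) : CMTypeOrbits))
    rw [← orbit_eq_orbit_orbitBase]
    obtain ⟨σ, hσ⟩ := MulAction.mem_orbit_iff.mp Φ.2
    refine MulAction.mem_orbit_iff.mpr ⟨σ, ?_⟩
    rw [← extendCMType_smul K h₀ σ (hσ ▸ isCMTypeWith_of_mem_orbit h₀ Φ)]
    exact extendCMType_congr K _ _ hσ⟩

/-- [cite: Milne1999, §2 p. 54 L33–L36] -/
@[simp] theorem coe_extendOrbitMap {Φ₀ : Set (K →ₐ[ℚ] cmNumbers)} (h₀ : IsCMTypeWith (cmNumbersConj : cmNumbers ≃ₐ[ℚ] cmNumbers) Φ₀)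
    (Φ : MulAction.orbit (cmNumbers ≃ₐ[ℚ] cmNumbers) Φ₀) :
    ((extendOrbitMap h₀ Φ : MulAction.orbit (cmNumbers ≃ₐ[ℚ] cmNumbers) (orbitBase (tIdx h₀))) : GalCMType) =
      extendCMType K (isCMTypeWith_of_mem_orbit h₀ Φ) := rfl

/-- `Φ ↦ Φ^{ℚ^{cm}}` is `Γ`-equivariant on orbits. [cite: Milne1999, §2 p. 54 L33–L36] -/
theorem extendOrbitMap_smul {Φ₀ : Set (K →ₐ[ℚ] cmNumbers)} (h₀ : IsCMTypeWith (cmNumbersConj : cmNumbers ≃ₐ[ℚ] cmNumbers) Φ₀)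
    (σ : cmNumbers ≃ₐ[ℚ] cmNumbers) (Φ : MulAction.orbit (cmNumbers ≃ₐ[ℚ] cmNumbers) Φ₀) :
    extendOrbitMap h₀ (σ • Φ) = σ • extendOrbitMap h₀ Φ := by
  refine Subtype.ext ?_
  change extendCMType K (isCMTypeWith_of_mem_orbit h₀ (σ • Φ)) = σ • extendCMType K (isCMTypeWith_of_mem_orbit h₀ Φ)
  rw [← extendCMType_smul K (isCMTypeWith_of_mem_orbit h₀ Φ) σ
    ((MulAction.orbit.coe_smul (a' := Φ) (m := σ)) ▸ isCMTypeWith_of_mem_orbit h₀ (σ • Φ))]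
  exact extendCMType_congr K _ _ MulAction.orbit.coe_smul

/-- **`X^*(T^Ψ)(K) → X^*(T^{Ψ(ℚ^{cm})})`, `[δ_Φ] ↦ [δ_{Φ^{ℚ^{cm}}}]`**: the orbit character module of `K` (g16-#6 `cmOrbitChar`) pushed to the summand of `X^*(T)`
at the class of `Ψ` (g16-#6 `OrbitTorus.push` along `Φ ↦ Φ^{ℚ^{cm}}`). [cite: Milne1999, §2 Thm 2.6 p. 56 («the case when [K : ℚ] is infinite follows by passing to the limit»)] -/
def tLevelOrbit {Φ₀ : Set (K →ₐ[ℚ] cmNumbers)} (h₀ : IsCMTypeWith (cmNumbersConj : cmNumbers ≃ₐ[ℚ] cmNumbers) Φ₀) :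
    cmOrbitChar ℤ Φ₀ →ₗ[ℤ] torusChar ℤ (orbitBase (tIdx h₀)) :=
  OrbitTorus.push ℤ cmNumbersConj (extendOrbitMap h₀) fun Φ => extendOrbitMap_smul h₀ cmNumbersConj Φ

/-- [cite: Milne1999, §2 Thm 2.6 p. 56] -/
@[simp] theorem tLevelOrbit_mk_single {Φ₀ : Set (K →ₐ[ℚ] cmNumbers)} (h₀ : IsCMTypeWith (cmNumbersConj : cmNumbers ≃ₐ[ℚ] cmNumbers) Φ₀)
    (Φ : MulAction.orbit (cmNumbers ≃ₐ[ℚ] cmNumbers) Φ₀) :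
    tLevelOrbit h₀ (Submodule.Quotient.mk (Finsupp.single Φ 1)) = Submodule.Quotient.mk (Finsupp.single (extendOrbitMap h₀ Φ) 1) :=
  OrbitTorus.push_mk_single ℤ cmNumbersConj _ _ Φ

/-- `t^Ψ ↦ t^{Ψ(ℚ^{cm})}`. [cite: Milne1999, §2 p. 55 L45–L48] -/
theorem tLevelOrbit_tCM {Φ₀ : Set (K →ₐ[ℚ] cmNumbers)} (h₀ : IsCMTypeWith (cmNumbersConj : cmNumbers ≃ₐ[ℚ] cmNumbers) Φ₀) :
    tLevelOrbit h₀ (tCM ℤ Φ₀) = tTorus ℤ (orbitBase (tIdx h₀)) :=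
  (OrbitTorus.push_tChar ℤ cmNumbersConj (extendOrbitMap h₀) (fun Φ => extendOrbitMap_smul h₀ cmNumbersConj Φ) _).trans
    (tTorus_eq_tChar ℤ _ _).symm

/-- The summand map is `Γ`-equivariant. [cite: Milne1999, §2 Thm 2.6 p. 56] -/
theorem tLevelOrbit_rep {Φ₀ : Set (K →ₐ[ℚ] cmNumbers)} (h₀ : IsCMTypeWith (cmNumbersConj : cmNumbers ≃ₐ[ℚ] cmNumbers) Φ₀)
    (σ : cmNumbers ≃ₐ[ℚ] cmNumbers) (x : cmOrbitChar ℤ Φ₀) :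
    tLevelOrbit h₀ (cmOrbitRep ℤ Φ₀ σ x) = torusRep ℤ (orbitBase (tIdx h₀)) σ (tLevelOrbit h₀ x) :=
  OrbitTorus.push_rep ℤ cmNumbersConj _ _ cmNumbersConj_mul_comm (extendOrbitMap_smul h₀) σ x

variable [IsCMField K]

/-- **On a summand, COMPATIBILITY WITH `γ`: `X^*(γ^{Ψ(ℚ^{cm})}) ∘ (X^*(T^Ψ)(K) → X^*(T^{Ψ(ℚ^{cm})})) = (X^*(S^K) ↪ X^*(S)) ∘ X^*(γ^Ψ)`** — on `[δ_Φ]` both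
sides are `𝟙_{Φ^{ℚ^{cm}}} = λ_Φ^{ℚ^{cm}}` (g21-#1 `indicatorI_extendCMType`, g16-#7 `gammaCharK_mk_single`, g20-#3 `extendLevel`). [cite: Milne1999, §3 p. 59 L1–L8, §6 p. 66 L33] -/
theorem gammaChar_comp_tLevelOrbit {Φ₀ : Set (K →ₐ[ℚ] cmNumbers)} (h₀ : IsCMTypeWith (cmNumbersConj : cmNumbers ≃ₐ[ℚ] cmNumbers) Φ₀) :
    gammaChar (orbitBase (tIdx h₀)) ∘ₗ tLevelOrbit h₀ = extendLevel K ∘ₗ gammaCharK h₀ :=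
  OrbitTorus.charModule_hom_ext ℤ cmNumbersConj fun Φ => by
    change gammaChar (orbitBase (tIdx h₀)) (tLevelOrbit h₀ (Submodule.Quotient.mk (Finsupp.single Φ 1))) =
      extendLevel K (gammaCharK h₀ (Submodule.Quotient.mk (Finsupp.single Φ 1)))
    rw [tLevelOrbit_mk_single, gammaChar_mk_single, gammaCharK_mk_single, coe_extendOrbitMap, indicatorI_extendCMType]

variable (K)
variable [IsGalois ℚ K] (𝔭 : Ideal (𝓞 K)) [h𝔭P : 𝔭.IsPrime] [h𝔭 : 𝔭.LiesOver (Ideal.span {(p : ℤ)})] (τ₀ : K →ₐ[ℚ] cmNumbers)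
variable {Γ₀ : Subgroup (K ≃ₐ[ℚ] K)} (h : Setting (conjGal : K ≃ₐ[ℚ] K) Γ₀ (decompositionGroup p 𝔭)) [DecidableEq (K ≃ₐ[ℚ] K)]
variable [DecidableEq CMTypeOrbits]

/-- **`⊕_{Ψ ∈ I(K)} X^*(T^Ψ)(K) → X^*(T)`**, summand by summand through `tLevelOrbit` (g18-#7's index set `I = CMOrbits h` of a `Setting` at a prime `𝔭 | p` of
`K` and an embedding `τ₀ : K → ℚ^{cm}`, representatives `Φ_c = repType`). [cite: Milne1999, §2 Thm 2.6 p. 56, §6 p. 66 L33 («On passing to the limit over all K ⊂ ℚ^{cm}»)] -/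
def tSumLevel : (∀ c : CMOrbits h, cmOrbitChar ℤ (repType p 𝔭 τ₀ h c)) →ₗ[ℤ] TChar where
  toFun f := ∑ c : CMOrbits h, dinj ℤ tFamT (tIdx (isCMTypeWith_repType p 𝔭 τ₀ h c)) (tLevelOrbit (isCMTypeWith_repType p 𝔭 τ₀ h c) (f c))
  map_add' f g := by simp only [Pi.add_apply, map_add, Finset.sum_add_distrib]
  map_smul' r f := by
    simp only [Pi.smul_apply, map_smul, RingHom.id_apply]
    exact Finset.smul_sum.symm

omit hp in
/-- [cite: Milne1999, §2 Thm 2.6 p. 56] -/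
theorem tSumLevel_apply (f : ∀ c : CMOrbits h, cmOrbitChar ℤ (repType p 𝔭 τ₀ h c)) :
    tSumLevel p K 𝔭 τ₀ h f =
      ∑ c : CMOrbits h, dinj ℤ tFamT (tIdx (isCMTypeWith_repType p 𝔭 τ₀ h c)) (tLevelOrbit (isCMTypeWith_repType p 𝔭 τ₀ h c) (f c)) := rfl

omit hp in
/-- On a single summand. [cite: Milne1999, §2 Thm 2.6 p. 56] -/
theorem tSumLevel_single (c : CMOrbits h) (x : cmOrbitChar ℤ (repType p 𝔭 τ₀ h c)) :
    tSumLevel p K 𝔭 τ₀ h (Pi.single c x) =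
      dinj ℤ tFamT (tIdx (isCMTypeWith_repType p 𝔭 τ₀ h c)) (tLevelOrbit (isCMTypeWith_repType p 𝔭 τ₀ h c) x) := by
  rw [tSumLevel_apply]
  refine (Finset.sum_eq_single c (fun c' _ hc' => ?_) (fun hc => absurd (Finset.mem_univ c) hc)).trans ?_
  · rw [Pi.single_eq_of_ne hc', map_zero, map_zero]
  · rw [Pi.single_eq_same]

omit hp in
/-- Every `δ_c t^{Ψ_c}` goes to `t`. [cite: Milne1999, §2 p. 55 L45–L48, Thm 2.6 p. 56] -/
theorem tSumLevel_single_tFamK (c : CMOrbits h) : tSumLevel p K 𝔭 τ₀ h (Pi.single c (tFamK p 𝔭 τ₀ h c)) = tT := by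
  rw [tSumLevel_single]
  exact (congrArg (dinj ℤ tFamT _) (tLevelOrbit_tCM _)).trans (dinj_tTorus _)

/-- **THE LEVEL MAP `X^*(T^K)(K) → X^*(T)`** (g18-#7's `TKK`, the character module of `∏_{Ψ∈I(K)} (T^Ψ, t^Ψ)` built from `K`'s own orbit tori, into the
limit object): well defined on the amalgamated sum because every `t^{Ψ_c} ↦ t`. [cite: Milne1999, §2 Thm 2.6 p. 56 («passing to the limit over the CM-subfields»),
§6 p. 66 L33] -/
def tLevel : TKK p 𝔭 τ₀ h →ₗ[ℤ] TChar :=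
  (PairProduct.rel ℤ (tFamK p 𝔭 τ₀ h)).liftQ (tSumLevel p K 𝔭 τ₀ h) (by
    rw [PairProduct.rel, Submodule.span_le]
    rintro x ⟨c, c', rfl⟩
    rw [SetLike.mem_coe, LinearMap.mem_ker, map_sub, tSumLevel_single_tFamK, tSumLevel_single_tFamK, sub_self])

omit hp in
/-- [cite: Milne1999, §6 p. 66 L33] -/
@[simp] theorem tLevel_mk (x : ∀ c : CMOrbits h, cmOrbitChar ℤ (repType p 𝔭 τ₀ h c)) :
    tLevel p K 𝔭 τ₀ h (Submodule.Quotient.mk x) = tSumLevel p K 𝔭 τ₀ h x := rfl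

omit hp in
/-- `t^K ↦ t`: the level map is a map of pairs. [cite: Milne1999, §2 Thm 2.6 p. 56; §1 p. 48 L31–L35] -/
theorem tLevel_tKK [DecidablePred (· ∈ Γ₀)] : tLevel p K 𝔭 τ₀ h (tKK p 𝔭 τ₀ h) = tT := by
  rw [← mk_single_tFamK p 𝔭 τ₀ h (Quotient.mk'' (CosetGerm.psiType h)), tLevel_mk, tSumLevel_single_tFamK]

omit hp in
/-- **COMPATIBILITY WITH `γ`: `X^*(γ) ∘ (X^*(T^K)(K) → X^*(T)) = (X^*(S^K) ↪ X^*(S)) ∘ X^*(γ^K)`.** [cite: Milne1999, §3 p. 59 L1–L8, §6 p. 66 L33] -/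
theorem gammaT_comp_tLevel : gammaT ∘ₗ tLevel p K 𝔭 τ₀ h = extendLevel K ∘ₗ tKKToS p 𝔭 τ₀ h := by
  refine Submodule.linearMap_qext _ (LinearMap.pi_ext fun c y => ?_)
  change gammaT (tLevel p K 𝔭 τ₀ h (Submodule.Quotient.mk (Pi.single c y))) =
    extendLevel K (tKKToS p 𝔭 τ₀ h (Submodule.Quotient.mk (Pi.single c y)))
  rw [tLevel_mk, tKKToS_mk, tSumLevel_single, tSumKToS_single, gammaT_dinj]
  exact LinearMap.congr_fun (gammaChar_comp_tLevelOrbit (isCMTypeWith_repType p 𝔭 τ₀ h c)) y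

omit hp in
/-- Pointwise form. [cite: Milne1999, §3 p. 59 L1–L8, §6 p. 66 L33] -/
theorem gammaT_tLevel (x : TKK p 𝔭 τ₀ h) : gammaT (tLevel p K 𝔭 τ₀ h x) = extendLevel K (tKKToS p 𝔭 τ₀ h x) :=
  LinearMap.congr_fun (gammaT_comp_tLevel p K 𝔭 τ₀ h) x

end TLevel

/-! ### §2 The `L`-side level map `X^*(L^K)(K) → X^*(L)` and its compatibility with `β` -/

section LLevel

variable (p : ℕ) [hp : Fact p.Prime]

variable {p} in
/-- **`X^*(L^Π)(K) ≅ X^*(L^Π)`**: the orbit character module at a germ `ϖ ∈ W_{1,+}(p^∞)` is the summand of `X^*(L)` at its class (same orbit, base point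
`ϖ_{[ϖ]}`). [cite: Milne1999, §4 p. 60 L25–L26 («independent of the choice of π ∈ Π»)] -/
def lLevelOrbit (ϖ : WeilLimit p) (hϖ : ϖ ∈ weilLimOnePlus p) : weilOrbitChar ℤ ϖ ≃ₗ[ℤ] weilOrbitChar ℤ (lBase (lClass p ϖ hϖ)) :=
  orbitCharCongr (orbit_lBase_lClass ϖ hϖ).symm

variable {p} in
/-- [cite: Milne1999, §4 p. 60 L25–L26] -/
theorem lLevelOrbit_mk_single (ϖ : WeilLimit p) (hϖ : ϖ ∈ weilLimOnePlus p) (π : MulAction.orbit (cmNumbers ≃ₐ[ℚ] cmNumbers) ϖ) (r : ℤ) :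
    lLevelOrbit ϖ hϖ (Submodule.Quotient.mk (Finsupp.single π r)) =
      Submodule.Quotient.mk (Finsupp.single ⟨π.1, (orbit_lBase_lClass ϖ hϖ).symm ▸ π.2⟩ r) :=
  orbitCharCongr_mk_single _ π r

variable {p} in
/-- `l^Π ↦ l^Π`. [cite: Milne1999, §4 p. 60 L25–L27] -/
theorem lLevelOrbit_lWeil (ϖ : WeilLimit p) (hϖ : ϖ ∈ weilLimOnePlus p) : lLevelOrbit ϖ hϖ (lWeil ℤ ϖ) = lWeil ℤ (lBase (lClass p ϖ hϖ)) :=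
  (OrbitTorus.congr_tChar ℤ cmNumbersConj (Equiv.setCongr (orbit_lBase_lClass ϖ hϖ).symm) (fun _ _ => Subtype.ext rfl) _).trans
    (lWeil_eq_tChar ℤ _ _).symm

variable {p} in
/-- The identification is `Γ`-equivariant. [cite: Milne1999, §4 p. 60 L25–L27] -/
theorem lLevelOrbit_rep (ϖ : WeilLimit p) (hϖ : ϖ ∈ weilLimOnePlus p) (σ : cmNumbers ≃ₐ[ℚ] cmNumbers) (y : weilOrbitChar ℤ ϖ) :
    lLevelOrbit ϖ hϖ (weilOrbitRep ℤ ϖ σ y) = weilOrbitRep ℤ (lBase (lClass p ϖ hϖ)) σ (lLevelOrbit ϖ hϖ y) :=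
  OrbitTorus.congr_rep ℤ cmNumbersConj (Equiv.setCongr (orbit_lBase_lClass ϖ hϖ).symm) (fun _ _ => Subtype.ext rfl)
    cmNumbersConj_mul_comm σ y

variable {p} in
/-- Generators of `X^*(L)` with equal data are equal (re-indexing plumbing). [folklore] -/
private theorem dinj_lFamL_mk_single_eq [DecidableEq (MulAction.orbitRel.Quotient (cmNumbers ≃ₐ[ℚ] cmNumbers) (WeilLimit p))]
    {c₁ c₂ : WeilOnePlusOrbits p} (hc : c₁ = c₂) (π₁ : MulAction.orbit (cmNumbers ≃ₐ[ℚ] cmNumbers) (lBase c₁))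
    (π₂ : MulAction.orbit (cmNumbers ≃ₐ[ℚ] cmNumbers) (lBase c₂)) (r : ℤ) (hπ : (π₁ : WeilLimit p) = π₂) :
    dinj ℤ lFamL c₁ (Submodule.Quotient.mk (Finsupp.single π₁ r)) = dinj ℤ lFamL c₂ (Submodule.Quotient.mk (Finsupp.single π₂ r)) := by
  subst hc
  obtain rfl : π₁ = π₂ := Subtype.ext hπ
  rfl

variable (K : IntermediateField ℚ cmNumbers) [FiniteDimensional ℚ K] [IsCMField K] [IsGalois ℚ K] (τ₀ : K →ₐ[ℚ] cmNumbers)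

omit [IsGalois ℚ K] in
/-- `X^*(P^K) ↪ X^*(P)` is injective. [cite: Milne1999, §4 p. 61 L20–L21] -/
theorem weilLimitInSubtype_injective' : Function.Injective (weilLimitInSubtype p τ₀) := fun a b hab => by
  rw [weilLimitInSubtype_apply, weilLimitInSubtype_apply] at hab
  exact Additive.toMul.injective (Subtype.ext (Additive.ofMul.injective hab))

/-- **On a summand, COMPATIBILITY WITH `β`: `X^*(β^Π) ∘ (X^*(L^Π)(K) ≅ X^*(L^Π)) = (X^*(P^K) ↪ X^*(P)) ∘ X^*(β^Π)(K)`** — on `[δ_π]` both sides are `[π]`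
(g16-#7 `betaCharIn_mk_single`, g16-#3 `weilLimitInSubtype`). [cite: Milne1999, §4 p. 62 L17–L31] -/
theorem betaChar_comp_lLevelOrbit (ϖ : WeilLimit p) (hϖ : ϖ ∈ weilLimitInOnePlus K p τ₀) :
    betaChar (lBase (lClass p ϖ hϖ.2)) (weilLimExp_lBase _) ∘ₗ (lLevelOrbit ϖ hϖ.2).toLinearMap =
      weilLimitInSubtype p τ₀ ∘ₗ betaCharIn p τ₀ ϖ hϖ :=
  OrbitTorus.charModule_hom_ext ℤ cmNumbersConj fun π => by
    change betaChar (lBase (lClass p ϖ hϖ.2)) (weilLimExp_lBase _) (lLevelOrbit ϖ hϖ.2 (Submodule.Quotient.mk (Finsupp.single π 1))) =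
      weilLimitInSubtype p τ₀ (betaCharIn p τ₀ ϖ hϖ (Submodule.Quotient.mk (Finsupp.single π 1)))
    rw [lLevelOrbit_mk_single, betaChar_mk_single, betaCharIn_mk_single, weilLimitInSubtype_apply, toMul_ofMul]

variable (𝔭 : Ideal (𝓞 K)) [h𝔭P : 𝔭.IsPrime] [h𝔭 : 𝔭.LiesOver (Ideal.span {(p : ℤ)})]
variable {Γ₀ : Subgroup (K ≃ₐ[ℚ] K)} (h : Setting (conjGal : K ≃ₐ[ℚ] K) Γ₀ (decompositionGroup p 𝔭)) [DecidableEq (K ≃ₐ[ℚ] K)]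
variable [DecidableEq (MulAction.orbitRel.Quotient (cmNumbers ≃ₐ[ℚ] cmNumbers) (WeilLimit p))]

/-- **`⊕_{Π ∈ I′(K)} X^*(L^Π)(K) → X^*(L)`**, summand by summand (g18-#7's index set `I′ = WeilOrbits ℤ h`, representatives `ϖ_{c′} = repGerm`).
[cite: Milne1999, §4 Thm 4.3 p. 61, p. 62 L28–L31 («On passing to the inverse limit over all K»)] -/
def lSumLevel : (∀ c' : WeilOrbits ℤ h, weilOrbitChar ℤ (repGerm p 𝔭 τ₀ h c')) →ₗ[ℤ] LChar p where
  toFun f := ∑ c' : WeilOrbits ℤ h, dinj ℤ lFamL (lClass p _ (repGerm_mem p 𝔭 τ₀ h c').2) (lLevelOrbit _ (repGerm_mem p 𝔭 τ₀ h c').2 (f c'))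
  map_add' f g := by simp only [Pi.add_apply, map_add, Finset.sum_add_distrib]
  map_smul' r f := by
    simp only [Pi.smul_apply, map_smul, RingHom.id_apply]
    exact Finset.smul_sum.symm

/-- [cite: Milne1999, §4 Thm 4.3 p. 61] -/
theorem lSumLevel_apply (f : ∀ c' : WeilOrbits ℤ h, weilOrbitChar ℤ (repGerm p 𝔭 τ₀ h c')) :
    lSumLevel p K τ₀ 𝔭 h f =
      ∑ c' : WeilOrbits ℤ h, dinj ℤ lFamL (lClass p _ (repGerm_mem p 𝔭 τ₀ h c').2) (lLevelOrbit _ (repGerm_mem p 𝔭 τ₀ h c').2 (f c')) := rfl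

/-- On a single summand. [cite: Milne1999, §4 Thm 4.3 p. 61] -/
theorem lSumLevel_single (c' : WeilOrbits ℤ h) (y : weilOrbitChar ℤ (repGerm p 𝔭 τ₀ h c')) :
    lSumLevel p K τ₀ 𝔭 h (Pi.single c' y) =
      dinj ℤ lFamL (lClass p _ (repGerm_mem p 𝔭 τ₀ h c').2) (lLevelOrbit _ (repGerm_mem p 𝔭 τ₀ h c').2 y) := by
  rw [lSumLevel_apply]
  refine (Finset.sum_eq_single c' (fun c'' _ hc'' => ?_) (fun hc => absurd (Finset.mem_univ c') hc)).trans ?_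
  · rw [Pi.single_eq_of_ne hc'', map_zero, map_zero]
  · rw [Pi.single_eq_same]

/-- Every `δ_{c′} l^{Π_{c′}}` goes to `l`. [cite: Milne1999, §4 p. 60 L25–L27, Thm 4.3 p. 61] -/
theorem lSumLevel_single_lFamK (c' : WeilOrbits ℤ h) : lSumLevel p K τ₀ 𝔭 h (Pi.single c' (lFamK p 𝔭 τ₀ h c')) = lL p := by
  rw [lSumLevel_single]
  exact (congrArg (dinj ℤ lFamL _) (lLevelOrbit_lWeil _ _)).trans (dinj_lWeil _)

/-- **THE LEVEL MAP `X^*(L^K)(K) → X^*(L)`** (g18-#7's `LKK` into the limit object). [cite: Milne1999, §4 p. 62 L28–L31, Thm 4.3 p. 61] -/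
def lLevel : LKK p 𝔭 τ₀ h →ₗ[ℤ] LChar p :=
  (PairProduct.rel ℤ (lFamK p 𝔭 τ₀ h)).liftQ (lSumLevel p K τ₀ 𝔭 h) (by
    rw [PairProduct.rel, Submodule.span_le]
    rintro x ⟨c, c', rfl⟩
    rw [SetLike.mem_coe, LinearMap.mem_ker, map_sub, lSumLevel_single_lFamK, lSumLevel_single_lFamK, sub_self])

/-- [cite: Milne1999, §4 p. 62 L28–L31] -/
@[simp] theorem lLevel_mk (y : ∀ c' : WeilOrbits ℤ h, weilOrbitChar ℤ (repGerm p 𝔭 τ₀ h c')) :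
    lLevel p K τ₀ 𝔭 h (Submodule.Quotient.mk y) = lSumLevel p K τ₀ 𝔭 h y := rfl

/-- `l^K ↦ l`: the level map is a map of pairs. [cite: Milne1999, §4 Thm 4.3 p. 61; §1 p. 48 L31–L35] -/
theorem lLevel_lKK [DecidablePred (· ∈ Γ₀)] : lLevel p K τ₀ 𝔭 h (lKK p 𝔭 τ₀ h) = lL p := by
  rw [← mk_single_lFamK p 𝔭 τ₀ h (CosetGerm.redI ℤ h (Quotient.mk'' (CosetGerm.psiType h))), lLevel_mk, lSumLevel_single_lFamK]

/-- **COMPATIBILITY WITH `β`: `X^*(β) ∘ (X^*(L^K)(K) → X^*(L)) = (X^*(P^K) ↪ X^*(P)) ∘ X^*(β^K)`.** [cite: Milne1999, §4 p. 62 L17–L31] -/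
theorem betaL_comp_lLevel : betaL p ∘ₗ lLevel p K τ₀ 𝔭 h = weilLimitInSubtype p τ₀ ∘ₗ lKKToP p 𝔭 τ₀ h := by
  refine Submodule.linearMap_qext _ (LinearMap.pi_ext fun c' y => ?_)
  change betaL p (lLevel p K τ₀ 𝔭 h (Submodule.Quotient.mk (Pi.single c' y))) =
    weilLimitInSubtype p τ₀ (lKKToP p 𝔭 τ₀ h (Submodule.Quotient.mk (Pi.single c' y)))
  rw [lLevel_mk, lKKToP_mk, lSumLevel_single, lSumKToP_single, betaL_dinj]
  exact LinearMap.congr_fun (betaChar_comp_lLevelOrbit p K τ₀ _ (repGerm_mem p 𝔭 τ₀ h c')) y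

/-- Pointwise form. [cite: Milne1999, §4 p. 62 L17–L31] -/
theorem betaL_lLevel (y : LKK p 𝔭 τ₀ h) : betaL p (lLevel p K τ₀ 𝔭 h y) = weilLimitInSubtype p τ₀ (lKKToP p 𝔭 τ₀ h y) :=
  LinearMap.congr_fun (betaL_comp_lLevel p K τ₀ 𝔭 h) y

end LLevel

/-! ### §3 A finite Galois CM level `E ⊂ ℚ^{cm}` with a `Setting` at the prime `𝔴 ∩ E`: compatibility with `α′`, with `α`, and THE LIFT at level `E` -/

section Level

variable (p : ℕ) [hp : Fact p.Prime] (𝔴 : Ideal (𝓞 cmNumbers)) [h𝔴P : 𝔴.IsPrime] [h𝔴 : 𝔴.LiesOver (Ideal.span {(p : ℤ)})]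

/-- `π(Φ)` depends on the prime only through the ideal (instance arguments are irrelevant). [cite: Milne1999, §5 pp. 64–65] -/
theorem cmTypeGerm_congr_prime {K : Type} [Field K] [NumberField K] [IsCMField K] {𝔭 𝔭' : Ideal (𝓞 K)} [𝔭.IsPrime]
    [𝔭.LiesOver (Ideal.span {(p : ℤ)})] [𝔭'.IsPrime] [𝔭'.LiesOver (Ideal.span {(p : ℤ)})] (e : 𝔭 = 𝔭') {Φ : Set (K →ₐ[ℚ] cmNumbers)}
    (hΦ : IsCMTypeWith (cmNumbersConj : cmNumbers ≃ₐ[ℚ] cmNumbers) Φ) : cmTypeGerm p 𝔭 hΦ = cmTypeGerm p 𝔭' hΦ := by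
  subst e
  rfl

variable (E : FiniteGaloisIntermediateField ℚ cmNumbers) [hE : IsCMField (E : IntermediateField ℚ cmNumbers)]
variable (𝔭 : Ideal (𝓞 (E : IntermediateField ℚ cmNumbers))) [h𝔭P : 𝔭.IsPrime] [h𝔭 : 𝔭.LiesOver (Ideal.span {(p : ℤ)})]
  (h𝔭𝔴 : 𝔭 = 𝔴.under (𝓞 (E : IntermediateField ℚ cmNumbers)))

include h𝔭𝔴

/-- **At the coherent prime `𝔭 = 𝔴 ∩ E` the limit germ of the extended type IS the level germ: `π(Φ^{ℚ^{cm}}) = π(Φ)`** (g21-#1 `cmTypeGermLim_extendCMType`).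
[cite: Milne1999, §5 p. 63 L6–L9, §6 p. 65 («w₀ is a fixed prime of ℚ^{al} lying over p»)] -/
theorem cmTypeGermLim_extendCMType_of_eq {Φ : Set ((E : IntermediateField ℚ cmNumbers) →ₐ[ℚ] cmNumbers)}
    (hΦ : IsCMTypeWith (cmNumbersConj : cmNumbers ≃ₐ[ℚ] cmNumbers) Φ) :
    cmTypeGermLim p 𝔴 (extendCMType (E : IntermediateField ℚ cmNumbers) hΦ) = cmTypeGerm p 𝔭 hΦ :=
  (cmTypeGermLim_extendCMType p 𝔴 E hΦ).trans (cmTypeGerm_congr_prime p h𝔭𝔴.symm hΦ)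

/-- **COMPATIBILITY WITH `α` at the coherent prime: `X^*(α) ∘ (X^*(S^E) ↪ X^*(S)) = (X^*(P^E) ↪ X^*(P)) ∘ X^*(α^E)`** (g20-#3 `alphaLim_extendLevel`: `α`
IS `α^E_{𝔴∩E}` on the level). [cite: Milne1999, §5 p. 63 Rem. 5.2 (a), §6 p. 65 («w₀ is a fixed prime of ℚ^{al} lying over p»)] -/
theorem alphaLim_extendLevel_of_eq (τ₀ : (E : IntermediateField ℚ cmNumbers) →ₐ[ℚ] cmNumbers)
    (g : infinityTypes (cmNumbers ≃ₐ[ℚ] cmNumbers) ((E : IntermediateField ℚ cmNumbers) →ₐ[ℚ] cmNumbers) cmNumbersConj) :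
    alphaLim p 𝔴 (extendLevel (E : IntermediateField ℚ cmNumbers) g) = weilLimitInSubtype p τ₀ (alphaCharIn p 𝔭 τ₀ g) := by
  rw [alphaLim_extendLevel, weilLimitInSubtype_alphaCharIn]
  exact alphaCharOfPrime_congr p h𝔭𝔴.symm g

variable (τ₀ : (E : IntermediateField ℚ cmNumbers) →ₐ[ℚ] cmNumbers)
variable {Γ₀ : Subgroup ((E : IntermediateField ℚ cmNumbers) ≃ₐ[ℚ] (E : IntermediateField ℚ cmNumbers))}
  (h : Setting (conjGal : (E : IntermediateField ℚ cmNumbers) ≃ₐ[ℚ] (E : IntermediateField ℚ cmNumbers)) Γ₀ (decompositionGroup p 𝔭))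
  [DecidableEq ((E : IntermediateField ℚ cmNumbers) ≃ₐ[ℚ] (E : IntermediateField ℚ cmNumbers))]
variable [DecidableEq CMTypeOrbits] [DecidableEq (MulAction.orbitRel.Quotient (cmNumbers ≃ₐ[ℚ] cmNumbers) (WeilLimit p))]

omit [DecidableEq CMTypeOrbits] in
/-- **On a summand, COMPATIBILITY WITH `α′`** — on `[δ_Φ]` both `X^*(α′) ∘ (level map)` and `(level map) ∘ X^*(α′^E)` give `[δ_{π(Φ)}]` in the summand
`X^*(L^{Π(Ψ)})`: the limit germ of the extended type is the level germ (`cmTypeGermLim_extendCMType_of_eq`), and the class of `π(Φ_c)` is that of `ϖ_{π(c)}`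
(g18-#7 `orbit_cmTypeGerm_repType`). [cite: Milne1999, §5 p. 65 L1–L9, §6 p. 66 L9–L12, L33] -/
theorem alphaPrimeOrbit_comp_tLevelOrbit (c : CMOrbits h) :
    dinj ℤ lFamL (redIdx p 𝔴 (tIdx (isCMTypeWith_repType p 𝔭 τ₀ h c))) ∘ₗ alphaPrimeOrbit p 𝔴 (tIdx (isCMTypeWith_repType p 𝔭 τ₀ h c)) ∘ₗ
        tLevelOrbit (isCMTypeWith_repType p 𝔭 τ₀ h c) =
      dinj ℤ lFamL (lClass p _ (repGerm_mem p 𝔭 τ₀ h (CosetGerm.redI ℤ h c)).2) ∘ₗ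
        (lLevelOrbit _ (repGerm_mem p 𝔭 τ₀ h (CosetGerm.redI ℤ h c)).2).toLinearMap ∘ₗ (germCast p 𝔭 τ₀ h c).toLinearMap ∘ₗ
          redChar p 𝔭 (isCMTypeWith_repType p 𝔭 τ₀ h c) :=
  OrbitTorus.charModule_hom_ext ℤ cmNumbersConj fun Φ => by
    change dinj ℤ lFamL _ (alphaPrimeOrbit p 𝔴 _ (tLevelOrbit (isCMTypeWith_repType p 𝔭 τ₀ h c) (Submodule.Quotient.mk (Finsupp.single Φ 1)))) =
      dinj ℤ lFamL _ (lLevelOrbit _ (repGerm_mem p 𝔭 τ₀ h (CosetGerm.redI ℤ h c)).2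
        (germCast p 𝔭 τ₀ h c (redChar p 𝔭 (isCMTypeWith_repType p 𝔭 τ₀ h c) (Submodule.Quotient.mk (Finsupp.single Φ 1)))))
    simp only [tLevelOrbit_mk_single, alphaPrimeOrbit_mk_single, redChar_mk_single, germCast_mk_single, lLevelOrbit_mk_single]
    refine dinj_lFamL_mk_single_eq ?_ _ _ 1 ?_
    · rw [← lClass_cmTypeGermLim p 𝔴 _ (extendOrbitMap (isCMTypeWith_repType p 𝔭 τ₀ h c) Φ), lClass_eq_lClass_iff, coe_extendOrbitMap,
        cmTypeGermLim_extendCMType_of_eq p 𝔴 E 𝔭 h𝔭𝔴, ← orbit_cmTypeGerm_repType]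
      exact cmTypeGerm_mem_orbit p 𝔭 _ Φ
    · rw [coe_redLim, coe_extendOrbitMap, cmTypeGermLim_extendCMType_of_eq p 𝔴 E 𝔭 h𝔭𝔴]
      rfl

omit [DecidableEq CMTypeOrbits] in
/-- Pointwise form on a summand. [cite: Milne1999, §5 p. 65 L1–L9, §6 p. 66 L9–L12] -/
theorem alphaPrimeOrbit_tLevelOrbit (c : CMOrbits h) (z : cmOrbitChar ℤ (repType p 𝔭 τ₀ h c)) :
    dinj ℤ lFamL (redIdx p 𝔴 (tIdx (isCMTypeWith_repType p 𝔭 τ₀ h c)))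
        (alphaPrimeOrbit p 𝔴 (tIdx (isCMTypeWith_repType p 𝔭 τ₀ h c)) (tLevelOrbit (isCMTypeWith_repType p 𝔭 τ₀ h c) z)) =
      dinj ℤ lFamL (lClass p _ (repGerm_mem p 𝔭 τ₀ h (CosetGerm.redI ℤ h c)).2)
        (lLevelOrbit _ (repGerm_mem p 𝔭 τ₀ h (CosetGerm.redI ℤ h c)).2
          (germCast p 𝔭 τ₀ h c (redChar p 𝔭 (isCMTypeWith_repType p 𝔭 τ₀ h c) z))) :=
  LinearMap.congr_fun (alphaPrimeOrbit_comp_tLevelOrbit p 𝔴 E 𝔭 h𝔭𝔴 τ₀ h c) z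

/-- **COMPATIBILITY WITH `α′`: `X^*(α′) ∘ (X^*(T^E)(E) → X^*(T)) = (X^*(L^E)(E) → X^*(L)) ∘ X^*(α′^E)`.** [cite: Milne1999, §5 p. 65 L1–L9, §6 p. 66 L9–L12, L33] -/
theorem alphaPrimeT_comp_tLevel :
    alphaPrimeT p 𝔴 ∘ₗ tLevel p (E : IntermediateField ℚ cmNumbers) 𝔭 τ₀ h = lLevel p (E : IntermediateField ℚ cmNumbers) τ₀ 𝔭 h ∘ₗ alphaKK p 𝔭 τ₀ h := by
  refine Submodule.linearMap_qext _ (LinearMap.pi_ext fun c y => ?_)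
  change alphaPrimeT p 𝔴 (tLevel p (E : IntermediateField ℚ cmNumbers) 𝔭 τ₀ h (Submodule.Quotient.mk (Pi.single c y))) =
    lLevel p (E : IntermediateField ℚ cmNumbers) τ₀ 𝔭 h (alphaKK p 𝔭 τ₀ h (Submodule.Quotient.mk (Pi.single c y)))
  simp only [tLevel_mk, alphaKK_mk, lLevel_mk, tSumLevel_single, alphaSumK_single, lSumLevel_single, alphaPrimeT_dinj]
  exact alphaPrimeOrbit_tLevelOrbit p 𝔴 E 𝔭 h𝔭𝔴 τ₀ h c y

/-- Pointwise form. [cite: Milne1999, §5 p. 65 L1–L9, §6 p. 66 L33] -/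
theorem alphaPrimeT_tLevel (x : TKK p 𝔭 τ₀ h) :
    alphaPrimeT p 𝔴 (tLevel p (E : IntermediateField ℚ cmNumbers) 𝔭 τ₀ h x) = lLevel p (E : IntermediateField ℚ cmNumbers) τ₀ 𝔭 h (alphaKK p 𝔭 τ₀ h x) :=
  LinearMap.congr_fun (alphaPrimeT_comp_tLevel p 𝔴 E 𝔭 h𝔭𝔴 τ₀ h) x

set_option maxHeartbeats 400000 in
/-- **THE LIFT AT A LEVEL WITH A `Setting`** (THEOREM 6.1 at level `E`, g18-#7 `exact_pairProductK`, pushed into the limit objects): if `y ∈ X^*(L^E)(E)`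
and `g ∈ X^*(S^E)` have the same image in `X^*(P)`, then `(y, g)` read in `X^*(L) ⊕ X^*(S)` comes from `X^*(T)`. [cite: Milne1999, §6 p. 66 L5–L6
(Theorem 6.1), p. 68 L106–L110 («Completion of the proof of the Theorem 6.1. It suffices to prove that [the square of character groups of level K] is almost
Cartesian for all sufficiently large CM-fields K»), p. 72 L4–L7] -/
theorem exists_lift_of_level [DecidablePred (· ∈ Γ₀)] [DecidablePred (· ∈ decompositionGroup p 𝔭)] (y : LKK p 𝔭 τ₀ h)
    (g : infinityTypes (cmNumbers ≃ₐ[ℚ] cmNumbers) ((E : IntermediateField ℚ cmNumbers) →ₐ[ℚ] cmNumbers) cmNumbersConj)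
    (e : betaL p (lLevel p (E : IntermediateField ℚ cmNumbers) τ₀ 𝔭 h y) = alphaLim p 𝔴 (extendLevel (E : IntermediateField ℚ cmNumbers) g)) :
    ∃ x : TChar, alphaPrimeT p 𝔴 x = lLevel p (E : IntermediateField ℚ cmNumbers) τ₀ 𝔭 h y ∧
      gammaT x = extendLevel (E : IntermediateField ℚ cmNumbers) g := by
  have e' : lKKToP p 𝔭 τ₀ h y = alphaCharIn p 𝔭 τ₀ g := by
    apply weilLimitInSubtype_injective' p (E : IntermediateField ℚ cmNumbers) τ₀
    rw [← betaL_lLevel, e, alphaLim_extendLevel_of_eq p 𝔴 E 𝔭 h𝔭𝔴 τ₀]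
  obtain ⟨x, hx, hx'⟩ := (exact_pairProductK p 𝔭 τ₀ h y g).mp e'
  exact ⟨tLevel p (E : IntermediateField ℚ cmNumbers) 𝔭 τ₀ h x, by rw [alphaPrimeT_tLevel p 𝔴 E 𝔭 h𝔭𝔴, hx], by rw [gammaT_tLevel, hx']⟩

end Level

/-! ### §4 The finite Galois CM levels `E ⊂ ℚ^{cm}` EXHAUST `X^*(L)`; the levels with a `Setting` (an imaginary quadratic `Q ⊂ E` with `(p)` split) are cofinal -/

section Exhaust

variable (p : ℕ) [hp : Fact p.Prime]

/-- Transport of “two primes over `p`” between isomorphic quadratic fields (through the tree's decomposition law: a Legendre symbol of the discriminant for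
`p ≠ 2`, the discriminant mod `8` for `p = 2`). [cite: Marcus2018, Ch. 3 Thm. 25] -/
theorem ncard_primesOver_eq_two_of_algEquiv {Q Q' : Type*} [Field Q] [NumberField Q] [Field Q'] [NumberField Q'] (e : Q ≃ₐ[ℚ] Q')
    (h2 : Module.finrank ℚ Q = 2) (h : ((Ideal.span {(p : ℤ)}).primesOver (𝓞 Q)).ncard = 2) :
    ((Ideal.span {(p : ℤ)}).primesOver (𝓞 Q')).ncard = 2 := by
  have h2' : Module.finrank ℚ Q' = 2 := by rw [← e.toLinearEquiv.finrank_eq, h2]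
  have hd : NumberField.discr Q' = NumberField.discr Q := (NumberField.discr_eq_discr_of_algEquiv _ e).symm
  by_cases hp2 : p = 2
  · subst hp2
    have h8 : NumberField.discr Q % 8 = 1 :=
      (Literature.NumberTheory.QuadraticFields.Quadratic.ncard_primesOver_two_eq_two_iff h2).mp (by exact_mod_cast h)
    exact_mod_cast (Literature.NumberTheory.QuadraticFields.Quadratic.ncard_primesOver_two_eq_two_iff h2').mpr (by rw [hd]; exact h8)
  · exact (Literature.NumberTheory.QuadraticFields.Quadratic.ncard_primesOver_eq_two_iff_legendreSym h2' hp2).mpr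
      (by rw [hd]; exact (Literature.NumberTheory.QuadraticFields.Quadratic.ncard_primesOver_eq_two_iff_legendreSym h2 hp2).mp h)

/-- **THE LEVELS WITH A `Setting` ARE COFINAL**: every finite Galois level `E₂ ⊂ ℚ^{cm}` lies in a finite Galois level `E ⊂ ℚ^{cm}` containing a quadratic
subfield `Q`, not totally real, in which `(p)` splits — g19-#3's imaginary quadratic `Q ⊂ ℂ` with `(p)` split (`exists_cm_galois_extension_split`) is a CM
field, hence inside `ℚ^{cm}`, and `E = E₂ · (Galois closure of Q) ⊂ ℚ^{cm}` («is almost Cartesian for all sufficiently large CM-fields K ⊂ ℚ^{al} of finite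
degree over ℚ. We shall in fact prove it under the assumption that K – is finite and Galois over ℚ, – contains a quadratic imaginary extension Q of ℚ in which
(p) splits, – and is not equal to Q.»). [cite: Milne1999, §6 p. 68 L115 – p. 69 L7, p. 66 L33] -/
theorem exists_level_ge_with_split_quadratic (E₂ : FiniteGaloisIntermediateField ℚ cmNumbers) :
    ∃ E : FiniteGaloisIntermediateField ℚ cmNumbers, E₂ ≤ E ∧
      ∃ Q : IntermediateField ℚ (E : IntermediateField ℚ cmNumbers),
        Module.finrank ℚ Q = 2 ∧ ¬IsTotallyReal Q ∧ ((Ideal.span {(p : ℤ)}).primesOver (𝓞 Q)).ncard = 2 := by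
  obtain ⟨K₉, Q, _hKfd, hQfd, _hQK, _h1, _h2, _h3, _h4, h2Q, hQcm, hsplitQ, _h5, _h6, _h7, _h8⟩ :=
    SufficientlyLarge.exists_cm_galois_extension_split ℚ⟮(Complex.I : ℂ)⟯ isCMField_adjoin_I p
  haveI := hQfd
  haveI : NumberField Q := { to_charZero := inferInstance, to_finiteDimensional := hQfd }
  have hQcmN : Q ≤ cmNumbers := le_cmNumbers_of_isCMField Q hQcm
  let Q₁ : IntermediateField ℚ cmNumbers := IntermediateField.restrict hQcmN
  let e₁ : Q ≃ₐ[ℚ] Q₁ := IntermediateField.restrict_algEquiv hQcmN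
  haveI hQ₁fd : FiniteDimensional ℚ Q₁ := LinearEquiv.finiteDimensional e₁.toLinearEquiv
  obtain ⟨θ, hθ⟩ := Field.exists_primitive_element ℚ Q₁
  let E : FiniteGaloisIntermediateField ℚ cmNumbers := E₂ ⊔ FiniteGaloisIntermediateField.adjoin ℚ ({(θ : cmNumbers)} : Set cmNumbers)
  have hθE : (θ : cmNumbers) ∈ (E : IntermediateField ℚ cmNumbers) :=
    (FiniteGaloisIntermediateField.le_iff _ _).mp
      (le_sup_right : FiniteGaloisIntermediateField.adjoin ℚ ({(θ : cmNumbers)} : Set cmNumbers) ≤ E)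
      (FiniteGaloisIntermediateField.subset_adjoin ℚ _ (Set.mem_singleton (θ : cmNumbers)))
  have hQ₁E : Q₁ ≤ (E : IntermediateField ℚ cmNumbers) := fun y hy => by
    have hy' : (⟨y, hy⟩ : Q₁) ∈ ℚ⟮θ⟯ := by rw [hθ]; exact IntermediateField.mem_top
    have hy'' : y ∈ IntermediateField.map Q₁.val ℚ⟮θ⟯ := ⟨⟨y, hy⟩, hy', rfl⟩
    rw [IntermediateField.adjoin_map, Set.image_singleton] at hy''
    exact IntermediateField.adjoin_simple_le_iff.mpr hθE hy''
  let Q' : IntermediateField ℚ (E : IntermediateField ℚ cmNumbers) := IntermediateField.restrict hQ₁E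
  let e : Q ≃ₐ[ℚ] Q' := e₁.trans (IntermediateField.restrict_algEquiv hQ₁E)
  haveI hQ'fd : FiniteDimensional ℚ Q' := LinearEquiv.finiteDimensional e.toLinearEquiv
  haveI : NumberField Q' := { to_charZero := inferInstance, to_finiteDimensional := hQ'fd }
  have hQ'cm : IsCMField Q' := isCMField_of_ringEquiv e.symm.toRingEquiv hQcm
  refine ⟨E, le_sup_left, Q', ?_, fun hQ'tr => @not_isCMField_of_isTotallyReal _ _ _ hQ'tr hQ'cm,
    ncard_primesOver_eq_two_of_algEquiv p e h2Q hsplitQ⟩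
  rw [← e.toLinearEquiv.finrank_eq, h2Q]

variable [DecidableEq (MulAction.orbitRel.Quotient (cmNumbers ≃ₐ[ℚ] cmNumbers) (WeilLimit p))]

/-- The generators `[δ_Π δ_π]` of `X^*(L)` CARRIED BY a finite Galois level `E ∋ i` of `ℚ^{cm}`: `π ∈ W^E(p^∞)`. [cite: Milne1999, §4 p. 62 L28–L31] -/
def levelGens (E : FiniteGaloisIntermediateField ℚ cmNumbers) (hI : iCM ∈ (E : IntermediateField ℚ cmNumbers)) : Set (LChar p) :=
  haveI := isCMField_of_iCM_mem E hI
  {z | ∃ (c : WeilOnePlusOrbits p) (π : MulAction.orbit (cmNumbers ≃ₐ[ℚ] cmNumbers) (lBase c)) (r : ℤ),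
    (π : WeilLimit p) ∈ weilLimitIn (E : IntermediateField ℚ cmNumbers) p (resLevel (E : IntermediateField ℚ cmNumbers) 1) ∧
      z = dinj ℤ lFamL c (Submodule.Quotient.mk (Finsupp.single π r))}

/-- **The part of `X^*(L)` carried by the level `E`**: the span of the `[δ_Π r δ_π]`, `π ∈ W^E(p^∞)`. [cite: Milne1999, §4 p. 62 L28–L31] -/
def levelSpan (E : FiniteGaloisIntermediateField ℚ cmNumbers) (hI : iCM ∈ (E : IntermediateField ℚ cmNumbers)) : Submodule ℤ (LChar p) :=
  Submodule.span ℤ (levelGens p E hI)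

/-- Larger levels carry more (g20-#1 `weilLimitIn_le_of_algHom`). [cite: Milne1999, §4 p. 62 L28–L31] -/
theorem levelGens_mono {E E' : FiniteGaloisIntermediateField ℚ cmNumbers} (hI : iCM ∈ (E : IntermediateField ℚ cmNumbers))
    (hI' : iCM ∈ (E' : IntermediateField ℚ cmNumbers)) (hle : E ≤ E') : levelGens p E hI ⊆ levelGens p E' hI' := by
  rintro z ⟨c, π, r, hπ, rfl⟩
  haveI := isCMField_of_iCM_mem E hI
  haveI := isCMField_of_iCM_mem E' hI'
  exact ⟨c, π, r, weilLimitIn_le_of_algHom (p := p) (levelInclusion ((FiniteGaloisIntermediateField.le_iff _ _).mp hle))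
    (resLevel (E : IntermediateField ℚ cmNumbers) 1) (resLevel (E' : IntermediateField ℚ cmNumbers) 1) hπ, rfl⟩

/-- [cite: Milne1999, §4 p. 62 L28–L31] -/
theorem levelSpan_mono {E E' : FiniteGaloisIntermediateField ℚ cmNumbers} (hI : iCM ∈ (E : IntermediateField ℚ cmNumbers))
    (hI' : iCM ∈ (E' : IntermediateField ℚ cmNumbers)) (hle : E ≤ E') : levelSpan p E hI ≤ levelSpan p E' hI' :=
  Submodule.span_mono (levelGens_mono p hI hI' hle)

/-- **THE LEVELS EXHAUST `X^*(L)`**: every character of `L` is carried by some finite Galois CM level `E ⊂ ℚ^{cm}` (each `π ∈ W_{1,+}(p^∞)` lies in some `W^E(p^∞)`,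
g21-#1 `exists_finiteGaloisLevel_mem_weilLimitIn`; the levels are directed). [cite: Milne1999, §4 p. 62 L28–L31 («On passing to the inverse limit over all K»), §6 p. 66 L33] -/
theorem exists_level_mem_levelSpan (y : LChar p) :
    ∃ (E : FiniteGaloisIntermediateField ℚ cmNumbers) (hI : iCM ∈ (E : IntermediateField ℚ cmNumbers)), y ∈ levelSpan p E hI := by
  induction y using PairProduct.induction_on ℤ lFamL with
  | zero => exact ⟨levelI, iCM_mem_levelI, Submodule.zero_mem _⟩
  | dinj c x =>
    induction x using Submodule.Quotient.induction_on with | H f => ?_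
    induction f using Finsupp.induction_linear with
    | zero => exact ⟨levelI, iCM_mem_levelI, by rw [Submodule.Quotient.mk_zero, map_zero]; exact Submodule.zero_mem _⟩
    | add f₁ f₂ h₁ h₂ =>
      obtain ⟨E₁, hI₁, hy₁⟩ := h₁
      obtain ⟨E₂, hI₂, hy₂⟩ := h₂
      refine ⟨E₁ ⊔ E₂, (FiniteGaloisIntermediateField.le_iff _ _).mp le_sup_left hI₁, ?_⟩
      rw [Submodule.Quotient.mk_add, map_add]
      exact Submodule.add_mem _ (levelSpan_mono p hI₁ _ le_sup_left hy₁) (levelSpan_mono p hI₂ _ le_sup_right hy₂)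
    | single π r =>
      obtain ⟨E, hEcm, hπ⟩ := exists_finiteGaloisLevel_mem_weilLimitIn p (π : WeilLimit p)
      have hI : iCM ∈ ((E ⊔ levelI : FiniteGaloisIntermediateField ℚ cmNumbers) : IntermediateField ℚ cmNumbers) :=
        (FiniteGaloisIntermediateField.le_iff _ _).mp le_sup_right iCM_mem_levelI
      haveI := isCMField_of_iCM_mem _ hI
      refine ⟨E ⊔ levelI, hI, Submodule.subset_span ⟨c, π, r, ?_, rfl⟩⟩
      exact weilLimitIn_le_of_algHom (p := p) (levelInclusion ((FiniteGaloisIntermediateField.le_iff _ _).mp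
        (le_sup_left : E ≤ E ⊔ levelI))) (resLevel (E : IntermediateField ℚ cmNumbers) 1) (resLevel _ 1) hπ
  | add y₁ y₂ h₁ h₂ =>
    obtain ⟨E₁, hI₁, hy₁⟩ := h₁
    obtain ⟨E₂, hI₂, hy₂⟩ := h₂
    exact ⟨E₁ ⊔ E₂, (FiniteGaloisIntermediateField.le_iff _ _).mp le_sup_left hI₁,
      Submodule.add_mem _ (levelSpan_mono p hI₁ _ le_sup_left hy₁) (levelSpan_mono p hI₂ _ le_sup_right hy₂)⟩

variable (K : IntermediateField ℚ cmNumbers) [FiniteDimensional ℚ K] [IsCMField K] [IsGalois ℚ K]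
variable (𝔭 : Ideal (𝓞 K)) [h𝔭P : 𝔭.IsPrime] [h𝔭 : 𝔭.LiesOver (Ideal.span {(p : ℤ)})] (τ₀ : K →ₐ[ℚ] cmNumbers)
variable {Γ₀ : Subgroup (K ≃ₐ[ℚ] K)} (h : Setting (conjGal : K ≃ₐ[ℚ] K) Γ₀ (decompositionGroup p 𝔭)) [DecidableEq (K ≃ₐ[ℚ] K)]

omit [DecidableEq (MulAction.orbitRel.Quotient (cmNumbers ≃ₐ[ℚ] cmNumbers) (WeilLimit p))] in
/-- `π(Φ)` lies in the orbit of the representative germ `ϖ_{π(c′)}` of its class `c′ = π(class of Φ)` (g18-#7 `cmTypeGerm_repType_mem_orbit` for an arbitrary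
CM type `Φ` of `K`: both germs map to `c′` under the injective `π ↦ f_π`). [cite: Milne1999, §5 pp. 64–65; §6 p. 71 L15–L17] -/
theorem cmTypeGerm_mem_orbit_repGerm {Φ : Set (K →ₐ[ℚ] cmNumbers)} (hΦ : IsCMTypeWith (cmNumbersConj : cmNumbers ≃ₐ[ℚ] cmNumbers) Φ) :
    cmTypeGerm p 𝔭 hΦ ∈ MulAction.orbit (cmNumbers ≃ₐ[ℚ] cmNumbers) (repGerm p 𝔭 τ₀ h (weilOrbitClass p 𝔭 τ₀ h hΦ)) := by
  have hmem : red ℤ h (toCMTypes τ₀ h hΦ) ∈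
      MulAction.orbitRel.Quotient.orbit (weilOrbitClass p 𝔭 τ₀ h (isCMTypeWith_repTypeL p 𝔭 τ₀ h (weilOrbitClass p 𝔭 τ₀ h hΦ))) := by
    rw [weilOrbitClass_repTypeL]
    exact red_toCMTypes_mem_orbit_weilOrbitClass p 𝔭 τ₀ h hΦ
  obtain ⟨π, hπ⟩ := weilOrbitMap_surjective p 𝔭 τ₀ h (isCMTypeWith_repTypeL p 𝔭 τ₀ h (weilOrbitClass p 𝔭 τ₀ h hΦ)) ⟨_, hmem⟩
  have e1 : ((weilOrbitMap p 𝔭 τ₀ h _ π : MulAction.orbitRel.Quotient.orbit _) : WeilGerms ℤ h).1 = (red ℤ h (toCMTypes τ₀ h hΦ)).1 := by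
    rw [hπ]
  rw [coe_coe_weilOrbitMap, ← germToCosetFun_ofMul_cmTypeGerm p 𝔭 τ₀ h hΦ (cmTypeGerm_mem_weilLimitInOnePlus p 𝔭 τ₀ hΦ).1] at e1
  have e2 := congrArg (fun z => ((Additive.toMul z : weilLimitIn K p τ₀) : WeilLimit p)) (germToCosetFun_injective p 𝔭 τ₀ e1)
  change (π : WeilLimit p) = cmTypeGerm p 𝔭 hΦ at e2
  rw [← e2]
  exact π.2

/-- **A level with a `Setting` carries its own generators through `lLevel`**: for `π ∈ W^K(p^∞) ∩ Π`, `Π ⊂ W_{1,+}(p^∞)`, the generator `[δ_Π δ_π]` of `X^*(L)` is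
in the image of `X^*(L^K)(K) → X^*(L)` — `π = σ·π(Φ)` for a CM type `Φ` of `K` (g16-#6 `exists_cmTypeGerm_eq`, LEMMA 5.1) and `π(Φ) ∈ Γ·ϖ_{π(c′)}`.
[cite: Milne1999, §4 p. 62 L28–L31, §5 p. 63 Lemma 5.1, pp. 64–65] -/
theorem dinj_mk_single_mem_range_lLevel (c : WeilOnePlusOrbits p) (π : MulAction.orbit (cmNumbers ≃ₐ[ℚ] cmNumbers) (lBase c)) (r : ℤ)
    (hπ : (π : WeilLimit p) ∈ weilLimitIn K p τ₀) :
    dinj ℤ lFamL c (Submodule.Quotient.mk (Finsupp.single π r)) ∈ LinearMap.range (lLevel p K τ₀ 𝔭 h) := by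
  have hπ' : (π : WeilLimit p) ∈ weilLimitInOnePlus K p τ₀ := ⟨hπ, orbit_subset_weilLimOnePlus (lBase_mem c) π.2⟩
  obtain ⟨Φ, hΦ, hΦπ⟩ := exists_cmTypeGerm_eq p 𝔭 τ₀ hπ'
  have hmem : (π : WeilLimit p) ∈ MulAction.orbit (cmNumbers ≃ₐ[ℚ] cmNumbers) (repGerm p 𝔭 τ₀ h (weilOrbitClass p 𝔭 τ₀ h hΦ)) := by
    rw [← hΦπ]
    exact cmTypeGerm_mem_orbit_repGerm p K 𝔭 τ₀ h hΦ
  refine ⟨Submodule.Quotient.mk (Pi.single (weilOrbitClass p 𝔭 τ₀ h hΦ) (Submodule.Quotient.mk (Finsupp.single ⟨π, hmem⟩ r))), ?_⟩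
  rw [lLevel_mk, lSumLevel_single, lLevelOrbit_mk_single]
  refine dinj_lFamL_mk_single_eq ?_ _ _ r rfl
  rw [← lClass_lBase c, lClass_eq_lClass_iff, ← MulAction.orbit_eq_iff.mpr π.2]
  exact MulAction.mem_orbit_symm.mp hmem

/-- Hence the whole `levelSpan` of a finite Galois CM level `E` with a `Setting` lies in the image of `lLevel`. [cite: Milne1999, §4 p. 62 L28–L31, §6 p. 66 L33] -/
theorem levelSpan_le_range_lLevel (E : FiniteGaloisIntermediateField ℚ cmNumbers) (hI : iCM ∈ (E : IntermediateField ℚ cmNumbers))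
    [IsCMField (E : IntermediateField ℚ cmNumbers)] (𝔭 : Ideal (𝓞 (E : IntermediateField ℚ cmNumbers))) [𝔭.IsPrime]
    [𝔭.LiesOver (Ideal.span {(p : ℤ)})] {Γ₀ : Subgroup ((E : IntermediateField ℚ cmNumbers) ≃ₐ[ℚ] (E : IntermediateField ℚ cmNumbers))}
    (h : Setting (conjGal : (E : IntermediateField ℚ cmNumbers) ≃ₐ[ℚ] (E : IntermediateField ℚ cmNumbers)) Γ₀ (decompositionGroup p 𝔭))
    [DecidableEq ((E : IntermediateField ℚ cmNumbers) ≃ₐ[ℚ] (E : IntermediateField ℚ cmNumbers))] :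
    levelSpan p E hI ≤ LinearMap.range (lLevel p (E : IntermediateField ℚ cmNumbers) (resLevel (E : IntermediateField ℚ cmNumbers) 1) 𝔭 h) := by
  rw [levelSpan, Submodule.span_le]
  rintro z ⟨c, π, r, hπ, rfl⟩
  exact dinj_mk_single_mem_range_lLevel p (E : IntermediateField ℚ cmNumbers) 𝔭 (resLevel (E : IntermediateField ℚ cmNumbers) 1) h c π r hπ

end Exhaust

/-! ### §5 THEOREM 6.1 IN THE LIMIT, ON CHARACTERS: the square `X^*(T) → X^*(S)` over `X^*(L) → X^*(P)` is ALMOST CARTESIAN -/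

section Theorem61

variable (p : ℕ) [hp : Fact p.Prime] (𝔴 : Ideal (𝓞 cmNumbers)) [h𝔴P : 𝔴.IsPrime] [h𝔴 : 𝔴.LiesOver (Ideal.span {(p : ℤ)})]
variable [DecidableEq CMTypeOrbits] [DecidableEq (MulAction.orbitRel.Quotient (cmNumbers ≃ₐ[ℚ] cmNumbers) (WeilLimit p))]

/-- **The lift at a level that carries the data**: for a finite Galois CM level `E ⊂ ℚ^{cm}` containing a quadratic subfield `Q`, not totally real, in which `(p)`
splits (so that g18-#1's `cosetGermSetting` at `w₀ = 𝔴 ∩ E` is available), every `y ∈ X^*(L)` carried by `E` and every `g ∈ X^*(S^E)` with `β(y) = α(g^{ℚ^{cm}})`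
lift to `X^*(T)` (`levelSpan_le_range_lLevel`, `exists_lift_of_level`). [cite: Milne1999, §6 p. 66 L3–L4 (Theorem 6.1), p. 68 L106–L118, p. 72 L158–L160] -/
theorem exists_lift_of_carried (E : FiniteGaloisIntermediateField ℚ cmNumbers) (hI : iCM ∈ (E : IntermediateField ℚ cmNumbers))
    (Q : IntermediateField ℚ (E : IntermediateField ℚ cmNumbers)) (hQ : Module.finrank ℚ Q = 2) (hQi : ¬IsTotallyReal Q)
    (hsplit : ((Ideal.span {(p : ℤ)}).primesOver (𝓞 Q)).ncard = 2) {y : LChar p} (hy : y ∈ levelSpan p E hI)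
    (g : infinityTypes (cmNumbers ≃ₐ[ℚ] cmNumbers) ((E : IntermediateField ℚ cmNumbers) →ₐ[ℚ] cmNumbers) cmNumbersConj)
    (e : betaL p y = alphaLim p 𝔴 (extendLevel (E : IntermediateField ℚ cmNumbers) g)) :
    ∃ x : TChar, alphaPrimeT p 𝔴 x = y ∧ gammaT x = extendLevel (E : IntermediateField ℚ cmNumbers) g := by
  haveI : IsCMField (E : IntermediateField ℚ cmNumbers) := isCMField_of_iCM_mem E hI
  haveI : DecidableEq ((E : IntermediateField ℚ cmNumbers) ≃ₐ[ℚ] (E : IntermediateField ℚ cmNumbers)) := Classical.decEq _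
  haveI : DecidablePred (· ∈ Q.fixingSubgroup) := Classical.decPred _
  haveI : DecidablePred (· ∈ decompositionGroup p (𝔴.under (𝓞 (E : IntermediateField ℚ cmNumbers)))) := Classical.decPred _
  have hS := cosetGermSetting Q p (𝔴.under (𝓞 (E : IntermediateField ℚ cmNumbers))) hQ hQi hsplit
  obtain ⟨yE, rfl⟩ := levelSpan_le_range_lLevel p E hI _ hS hy
  exact exists_lift_of_level p 𝔴 E _ rfl _ hS yE g e

/-- **THE LIFT: `X^*(T) → X^*(L) ×_{X^*(P)} X^*(S)` IS ONTO** — if `y ∈ X^*(L)` and `n ∈ X^*(S)` have the same image in `X^*(P) = W(p^∞)`, there is `x ∈ X^*(T)` with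
`α′(x) = y` and `γ(x) = n`.  Proof: `y` is carried by a finite Galois CM level and `n` by `cmLevel n`; above both lies a level `E ⊂ ℚ^{cm}` with a quadratic
`Q ⊂ E`, not totally real, in which `(p)` splits (`exists_level_ge_with_split_quadratic`); there THEOREM 6.1 at level `E` (g18-#7 `exact_pairProductK` for g18-#1's
`cosetGermSetting`) lifts, and the level maps carry the lift into `X^*(T)` («We shall in fact prove it under the assumption that K … contains a quadratic imaginary
extension Q of ℚ in which (p) splits», p. 68 L119 – p. 69 L6; «On passing to the limit over all K ⊂ ℚ^{cm}», p. 66 L33).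
[cite: Milne1999, §6 p. 66 L5–L6 (Theorem 6.1), p. 68 L106–L119, p. 69 L1–L7, p. 72 L4–L7, p. 66 L33] -/
theorem exists_lift (y : LChar p) (n : infinityTypesCM) (e : betaL p y = alphaLim p 𝔴 n) : ∃ x : TChar, alphaPrimeT p 𝔴 x = y ∧ gammaT x = n := by
  obtain ⟨E₁, hI₁, hy⟩ := exists_level_mem_levelSpan p y
  obtain ⟨E, hE₂E, Q, hQ, hQi, hsplit⟩ := exists_level_ge_with_split_quadratic p (E₁ ⊔ cmLevel n)
  have h₁E : E₁ ≤ E := le_sup_left.trans hE₂E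
  have hI : iCM ∈ (E : IntermediateField ℚ cmNumbers) := (FiniteGaloisIntermediateField.le_iff _ _).mp h₁E hI₁
  have hn : (n : (cmNumbers ≃ₐ[ℚ] cmNumbers) → ℤ) ∈ lambdaLevel (E : IntermediateField ℚ cmNumbers) :=
    lambdaLevel_mono ((FiniteGaloisIntermediateField.le_iff _ _).mp (le_sup_right.trans hE₂E)) (mem_lambdaLevel_cmLevel n)
  have hg : extendLevel (E : IntermediateField ℚ cmNumbers) (levelChar (E : IntermediateField ℚ cmNumbers) n hn) = n :=
    extendLevel_levelChar (E : IntermediateField ℚ cmNumbers) n hn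
  obtain ⟨x, hx, hx'⟩ := exists_lift_of_carried p 𝔴 E hI Q hQ hQi hsplit (levelSpan_mono p hI₁ hI h₁E hy) _
    (e.trans (congrArg (alphaLim p 𝔴) hg).symm)
  exact ⟨x, hx, hx'.trans hg⟩

/-- **MILNE 1999 THEOREM 6.1 IN THE LIMIT, ON CHARACTERS: THE SQUARE OF CHARACTER GROUPS `X^*(T) −X^*(γ)→ X^*(S)` OVER `X^*(L) −X^*(β)→ X^*(P)`, WITH VERTICALS
`X^*(α′)` AND `X^*(α)`, IS ALMOST CARTESIAN** — it commutes (LEMMA 6.2 in the limit, g21-#1 `betaL_comp_alphaPrimeT`), all four maps are onto, and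
`X^*(T) → X^*(L) ×_{X^*(P)} X^*(S)` is onto (`exists_lift`).  This is the character-level content of «THEOREM 6.1. The diagram at left commutes, and identifies
P with L ∩ S (intersection in T).», to which the printed proof reduces it: «To complete the proof of Theorem 6.1 we shall show that P^K = S^K ∩ L^K (inside T^K),
or, equivalently, that P^K → L^K × S^K → T^K is exact, for all sufficiently large K ⊂ ℚ^{cm}» (p. 66 L34–L48) and «Completion of the proof of the Theorem 6.1.
It suffices to prove that [the square of character groups X^*(T^K) → X^*(S^K) over X^*(L^K) → X^*(P^K)] is almost Cartesian for all sufficiently large CM-fields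
K ⊂ ℚ^{al} of finite degree over ℚ» (p. 68 L106–L116); here for the limit square over ALL levels at once.  The identification of `T`, `L`, `S`, `P` with
fundamental groups of Tannakian categories of motives, and `P = L ∩ S` as an equality of subgroup schemes of `T`, are NOT claimed here; nothing here is a case
of the Hodge conjecture. [cite: Milne1999, §6 p. 65 L29–L44 (the four groups), p. 66 L5–L6 (Theorem 6.1), L34–L48, L50 ff. («Almost cartesian squares»),
p. 67 L5–L23 (Lemma 6.3), p. 68 L106–L119, p. 72 L4–L7 («Therefore the right-hand square is almost Cartesian, which completes the proof of Theorem 6.1»)] -/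
theorem isAlmostCartesian_charSquare : IsAlmostCartesian (alphaPrimeT p 𝔴) gammaT (betaL p) (alphaLim p 𝔴) where
  comm := betaL_alphaPrimeT p 𝔴
  surjective_left := alphaPrimeT_surjective p 𝔴
  surjective_top := gammaT_surjective
  surjective_bottom := betaL_surjective p
  surjective_right := alphaLim_surjective p 𝔴
  lift := exists_lift p 𝔴

/-- The same, as the fibre-product criterion: `β(y) = α(n) ↔ ∃ x, α′(x) = y ∧ γ(x) = n`. [cite: Milne1999, §6 p. 66 L3–L4, L13–L16] -/
theorem betaL_eq_alphaLim_iff (y : LChar p) (n : infinityTypesCM) :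
    betaL p y = alphaLim p 𝔴 n ↔ ∃ x : TChar, alphaPrimeT p 𝔴 x = y ∧ gammaT x = n := by
  constructor
  · exact exists_lift p 𝔴 y n
  · rintro ⟨x, rfl, rfl⟩
    exact betaL_alphaPrimeT p 𝔴 x

/-- **`X^*(T) → X^*(L) ⊕ X^*(S) → X^*(P)` IS EXACT** (the second map is `(y, n) ↦ β(y) − α(n)`; ` → 0` on the right from the surjectivity of `β`) — the
character-level form of «P^K = S^K ∩ L^K (inside T^K), or, equivalently, … P^K → L^K × S^K → T^K is exact», in the limit (the tree's
`isAlmostCartesian_iff_exact`). [cite: Milne1999, §6 p. 66 L34–L48, L50 ff. («almost cartesian»)] -/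
theorem exact_charSquare :
    Function.Exact (LinearMap.prod (alphaPrimeT p 𝔴) gammaT)
      ((betaL p).comp (LinearMap.fst ℤ (LChar p) infinityTypesCM) - (alphaLim p 𝔴).comp (LinearMap.snd ℤ (LChar p) infinityTypesCM)) :=
  (AlmostCartesian.isAlmostCartesian_iff_exact (betaL_alphaPrimeT p 𝔴) (alphaPrimeT_surjective p 𝔴) gammaT_surjective (betaL_surjective p)
    (alphaLim_surjective p 𝔴)).mp (isAlmostCartesian_charSquare p 𝔴)

/-- **LEMMA 6.3 (b) IN THE LIMIT: `Ker(X^*(γ)) → Ker(X^*(β))`, induced by `X^*(α′)`, IS ONTO** («(b) the map Ker γ → Ker β induced by α′ is surjective»): every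
character of `L` trivial on `P` comes from a character of `T` trivial on `S`. [cite: Milne1999, §6 p. 67 L5–L9 (Lemma 6.3 (b))] -/
theorem kerMap_surjective_charSquare :
    Function.Surjective (AlmostCartesian.kerMap (α' := alphaPrimeT p 𝔴) (γ := gammaT) (β := betaL p) (α := alphaLim p 𝔴) (betaL_alphaPrimeT p 𝔴)) :=
  (isAlmostCartesian_charSquare p 𝔴).kerMap_surjective

/-- **LEMMA 6.3 (c) IN THE LIMIT: `Ker(X^*(α′)) → Ker(X^*(α))`, induced by `X^*(γ)`, IS ONTO** («(c) the map Ker α′ → Ker α induced by γ is surjective»;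
at a finite level this is how the printed proof ends: «which implies that Ker(α′) → Ker(α) is surjective. Therefore the right-hand square is almost
Cartesian, which completes the proof of Theorem 6.1»): every character of `S` trivial on `P` comes from a character of `T` trivial on `L`.
[cite: Milne1999, §6 p. 67 L5–L9 (Lemma 6.3 (c)), p. 72 L4–L7] -/
theorem kerMap_surjective_charSquare_symm :
    Function.Surjective (AlmostCartesian.kerMap (α' := gammaT) (γ := alphaPrimeT p 𝔴) (β := alphaLim p 𝔴) (α := betaL p)
      fun x => (betaL_alphaPrimeT p 𝔴 x).symm) :=
  (isAlmostCartesian_charSquare p 𝔴).symm.kerMap_surjective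

end Theorem61

end CMNumbers

end Literature.NumberTheory.ComplexMultiplication

end
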